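import Mathlib
import HarnessLib
import HarnessLib.Audit
import Summits.HubbardSuperconductivity.Statement
import Literature.MathematicalPhysics.QuantumLattice.HeisenbergModel
import Summits.HubbardSuperconductivity.HubbardSuperconductivity.Theorems.FunctionFieldCertificateAssemblyStructural
import HarnessLib.Audit.Status.Attr

/-!
Route: FunctionFieldCertificate

DORMANT since 2026-08-23T20:55:54Z (reconciler: no traction for 6.2 d (last activity item-evidence-added at 2026-08-17T14:33:13Z); parked, not closed — `ledger route dormant route-HubbardSuperconductivity-FunctionFieldCertificate --off`) — unstaffed, not closed; items shared with open routes are served there. `ledger route dormant <id> --off` reactivates.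

# Route FunctionFieldCertificate — IR-weighted SOS+KKT certificates over Q(U)(e^ik) — mesoscopic
pair order (pole-free) + window infrared transfer (pole order 1), calibrated on XY and hard-core
bosons

It suffices to exhibit, at ONE rational point (U, δ) (target window U ∈ [4,6], δ ∈ [3/20,1/4], away
from the stripe box), a
FUNCTION-FIELD CERTIFICATE of d-wave pair order (card function-field-kkt-certificates; definition
request `SymbolCertificate`): finitely many
symbol-class SOS generators, KKT generators Q_m with multipliers allowed poles of declared order ≤ 2
on the infrared set, a Hermitian R-channel,
sector terms and a finite list of scalar Riemann-sum inequalities, such that L⁻⁴Δ_d†Δ_d − a·1 = SOS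
+ Σ Q_m†a_m[H_L,Q_m] + [H_L,R] + T + E_L,
‖E_L‖ ≤ C/L, holds on every torus — an identity between finitely many rational functions in
ℚ(U)(e^{ik}), read at the L-th roots of unity.
Its EVALUATION at each even L ≥ L₀ is the typed target `CertifiedSectorLRO` (X's semantic shadow: a
per-L SOS + Q†[H,Q] + [H,R] + sector-term
identity with slack C/L), which is sound in every (N_L, S^z = 0) sector ground state. By the card's
semantics the certificate splits into a
POLE-FREE half = mesoscopic pair order at every finite scale R in every ground state (crux
`MesoscopicPairOrder`, certifiable by finite-range
families, untouched by the twist no-go) and a POLE half = the window infrared transfer to k = 0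
(crux `WindowInfraredBound`, shared verbatim with
KacWindowPenalty stmt-1089, where pole order ≥ 1 is necessary); the Assembly glues them by a
Fejér-kernel Parseval identity on (ℤ/Lℤ)². This
realises the (IR) ∧ (FRC) shape of card form-factor-squeeze-odlro-equals-lro with the certificate
calculus as the engine for both halves, calibrated on the
S = 1/2 XY model (RP ground truth, crux filed informally: XyFunctionFieldCertificate) and on
hard-core bosons OFF half filling (no RP; ground-state BEC off half filling, open since ALSSY 2004 —
recorded as statement stmt-HubbardSuperconductivity-15001 and in the card's K3, NOT an item of this
route since rev 6: a calibration rung does not feed `closes`).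
Lean: `∃ U : ℝ, 0 < U ∧ ∃ δ ∈ Set.Ioo (0:ℝ) (1 / 2), ∃ a C : ℝ, 0 < a ∧ ∃ L₀ : ℕ, ∀ (L : ℕ) [NeZero
L], L₀ ≤ L → Even L → ∃ (n m : ℕ) (O : Fin n → Matrix (Finset
(Literature.MathematicalPhysics.QuantumLattice.Orb
(Literature.MathematicalPhysics.QuantumLattice.FermionTorus 2 L))) (Finset
(Literature.MathematicalPhysics.QuantumLattice.Orb
(Literature.MathematicalPhysics.QuantumLattice.FermionTorus 2 L))) ℂ) (Q : Fin m → Matrix (Finset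
(Literature.MathematicalPhysics.QuantumLattice.Orb
(Literature.MathematicalPhysics.QuantumLattice.FermionTorus 2 L))) (Finset
(Literature.MathematicalPhysics.QuantumLattice.Orb
(Literature.MathematicalPhysics.QuantumLattice.FermionTorus 2 L))) ℂ) (R T : Matrix (Finset
(Literature.MathematicalPhysics.QuantumLattice.Orb
(Literature.MathematicalPhysics.QuantumLattice.FermionTorus 2 L))) (Finset
(Literature.MathematicalPhysics.QuantumLattice.Orb
(Literature.MathematicalPhysics.QuantumLattice.FermionTorus 2 L))) ℂ), (∀ (i : Fin m) (ψ :
Literature.MathematicalPhysics.QuantumLattice.Fock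
(Literature.MathematicalPhysics.QuantumLattice.Orb
(Literature.MathematicalPhysics.QuantumLattice.FermionTorus 2 L))), ψ ∈
Literature.MathematicalPhysics.QuantumLattice.szSector (2 * ⌊(1 - δ) * (L : ℝ) ^ 2 / 2⌋₊) 0 →
Matrix.mulVec (Q i) ψ ∈ Literature.MathematicalPhysics.QuantumLattice.szSector (2 * ⌊(1 - δ) * (L :
ℝ) ^ 2 / 2⌋₊) 0) ∧ (∀ ψ : Literature.MathematicalPhysics.QuantumLattice.Fock
(Literature.MathematicalPhysics.QuantumLattice.Orb
(Literature.MathematicalPhysics.QuantumLattice.FermionTorus 2 L)), ψ ∈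
Literature.MathematicalPhysics.QuantumLattice.szSector (2 * ⌊(1 - δ) * (L : ℝ) ^ 2 / 2⌋₊) 0 → star ψ
⬝ᵥ Matrix.mulVec T ψ = 0) ∧ (1 / (L : ℂ) ^ 4) • (Matrix.conjTranspose
(Literature.MathematicalPhysics.QuantumLattice.pairField
Literature.MathematicalPhysics.QuantumLattice.dWaveFormFactor L) *
Literature.MathematicalPhysics.QuantumLattice.pairField
Literature.MathematicalPhysics.QuantumLattice.dWaveFormFactor L) - ((a - C / (L : ℝ) : ℝ) : ℂ) • (1
: Matrix (Finset (Literature.MathematicalPhysics.QuantumLattice.Orb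
(Literature.MathematicalPhysics.QuantumLattice.FermionTorus 2 L))) (Finset
(Literature.MathematicalPhysics.QuantumLattice.Orb
(Literature.MathematicalPhysics.QuantumLattice.FermionTorus 2 L))) ℂ) = ∑ i : Fin n,
Matrix.conjTranspose (O i) * O i + ∑ i : Fin m, Matrix.conjTranspose (Q i) *
(Literature.MathematicalPhysics.QuantumLattice.hubbardTorus 2 L 1 U * Q i - Q i *
Literature.MathematicalPhysics.QuantumLattice.hubbardTorus 2 L 1 U) +
(Literature.MathematicalPhysics.QuantumLattice.hubbardTorus 2 L 1 U * R - R *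
Literature.MathematicalPhysics.QuantumLattice.hubbardTorus 2 L 1 U) + T`

## Assembly
Fejér–Parseval glue on the dual torus (standard Fourier analysis on (ℤ/Lℤ)², elementary operator
bookkeeping; checked by hand, constants below). Take (U,δ,m)
from MesoscopicPairOrder and (C,ε₀,L₀) from WindowInfraredBound at that (U,δ); put ε := min(ε₀,
m/(8(C+1))), A_ε := 1/sin²(ε/(2√2)), choose R ≥ R₀ with
32A_ε/R² ≤ m/8 from MesoscopicPairOrder, and even L ≥ max(L₀, L₀(R), 2R+2). With F(m) := ‖Δ_d(m)ψ‖²,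
Ŵ_R(m) := Π_i F̂_R(m_i), F̂_R the Fejér kernel
(F̂_R(0) = R, 0 ≤ F̂_R(t) ≤ min(R, 1/(R sin²(πt/L))) for 2R ≤ L), Parseval gives Σ_m Ŵ_R(m)F(m) =
L⁴K_R(ψ) ≥ mR²L⁴; splitting m = 0 / window / tail:
R²⟨Δ_d†Δ_dψ,ψ⟩ ≥ L⁴K_R − R²·(CεL⁴) − A_ε·Σ_m F(m) and Σ_m F(m) = L²Σ_x‖P_xψ‖² ≤ 32L⁴, hence
L⁻⁴Re⟨Δ_d†Δ_d⟩ ≥ m − m/8 − m/8 = 3m/4 for EVERY sector ground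
state and every large even L; the summit's HasLongRangeOrder along even sides follows as in
CertificateSoundness (liminf ≥ 3m/4 > 0, bounded sequence).

Rationale: WHY THIS LINE. Route GSCertificate asked for an L-independent FINITE-RANGE operator identity and
card twist-witness-no-local-certificate shows none exists (U(1)-twisted
ground states pass every finite local SOS/KKT family to O(j/L) yet have no k = 0 order), while the
one certificate known nearby — Kennedy–Lieb–Shastry
(KLS1988PRL, KLS1988JSP; tree theorem kennedy_lieb_shastry_xy_ground_holds) — is a k-family with
weights 1/E(k): so the right object lives over the
function field of the Brillouin torus, ℚ(U)(e^{ik}), with infrared poles of declared order, and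
stays FINITELY PRESENTED and L-uniformly checkable
(rational identity by computer algebra; trigonometric positivity by weighted SOS /
Fejér–Riesz–Dritschel factorisation and the noncommutative Positivstellensatz,
doi:10.1007/s00020-002-1198-4, doi:10.1007/s00208-024-02895-9, doi:10.1090/S0002-9947-04-03433-6;
scalar
Riemann sums by certified numerics — the only non-algebraic step in KLS). Imported areas:
noncommutative polynomial optimisation and its
first-order (KKT) ground-state constraints (WangEtAl2024, FawziFawziScalet2024, KullEtAl2024,
arXiv:2410.00810, doi:10.1137/090760155), real algebraic
geometry of trigonometric polynomials, SOS degree lower bounds via pseudo-expectations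
(Grigoriev2001) for the negative branch, and the DLS/KLS infrared
calculus (DysonLiebSimon1978). What it does that prior routes do not: GSCertificate's interface is
empty and ShibaRP needs reflection positivity of a
doped fermion model; here the infrared bound itself must come out of an SOS+KKT identity, the no-go
is absorbed as a NECESSARY pole order (≥ 1;
KLS has 2), and the typed layer isolates exactly which half needs poles: mesoscopic order (none)
versus the k → 0 transfer (order 1).

RANKED CRUXES. #0 CertifiedSectorLRO (target) — X's typed shadow: there are U > 0, δ ∈ (0,1/2), a >
0, C and L₀ such that for every even L ≥ L₀ there exist finitely many matrices O_i,
sector-preserving Q_i, a matrix R and a sector term T (zero expectation on szSector N_L 0) with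
L⁻⁴·Δ_d†Δ_d − (a − C/L)·1 = Σ O_i†O_i + Σ Q_i†(H_L Q_i − Q_i H_L) + (H_L R − R H_L) + T, H_L =
hubbardTorus 2 L 1 U — exactly what evaluating a function-field certificate at the L-th roots of
unity produces. (why it might fail: By CertificateCompleteness it is EQUIVALENT to uniform
every-ground-state LRO ≥ a − C/L on all large even tori; fails iff S fails at every (U,δ) or the
finite-size approach to the order is slower than C/L from below.) [WangEtAl2024,
FawziFawziScalet2024, KLS1988PRL, doi:10.1007/s10208-026-09761-x]
#2 MesoscopicPairOrder (crux) — POLE-FREE HALF (card §5: what a Laurent-polynomial, i.e.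
finite-range, certificate can prove). At some U > 0, δ ∈ (0,1/2) there is m > 0 such that for
arbitrarily large scales R, all large even L and EVERY normalised (N_L,0)-sector ground state ψ of
hubbardTorus 2 L 1 U, the Fejér-box average of the d-wave pair correlation is ≥ m: L⁻² Σ_{x,y} Π_i
(1 − |(y−x)_i|_L/R)₊ Re⟨P_xψ, P_yψ⟩ ≥ m R² (P_x = localPair dWaveFormFactor L x). Twisted states do
not defeat it (a winding-j twist changes correlations at range R by O((jR/L)²)), so FINITE-RANGE
SOS+KKT families are admissible certificates here. [difficulty: open-problem] (why it might fail: It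
is d-wave SSB with a uniform margin in EVERY sector ground state at intermediate U: degenerate
ground spaces may mix towers with smaller correlations; degree-2 certificates see only GHF data
where repulsive U has no pairing (BLS), so degree ≥ 4 is forced.) [KomaTasaki1994, Tasaki2019Tower,
Literature.Barriers.HubbardSuperconductivity.GeneralizedHartreeFockNoPairing, QinEtAl2020,
WangEtAl2024]
#4 WindowInfraredBound (crux) — POLE HALF (shared verbatim with KacWindowPenalty,
stmt-HubbardSuperconductivity-1089). For every U > 0, δ ∈ (0,1/2) there are C, ε₀, L₀ such that for
ε ≤ ε₀, every even L ≥ L₀ and every normalised sector ground state ψ the window pair weight obeys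
Σ_{m ≠ 0, |q_m| ≤ ε} ‖Δ_d(m)ψ‖²/L² ≤ C ε L² (Δ_d(m) = Σ_x e^{−2πi m·x/L} P_x): the Goldstone-shaped,
Σ-form infrared bound — in certificate language the part carried by multipliers with a pole of order
1 at k = 0 (necessary by the twist witnesses; KLS's Gaussian domination gives order 2). [difficulty:
open-problem] (why it might fail: Stated for ALL (U,δ): an incommensurate pair-density-wave with |Q|
→ 0, phase separation, or a mesoscopic condensate at q ~ 1/L in some sector GS breaks the
linear-in-ε window law; no RP-free infrared bound is known for any itinerant model.) [KLS1988PRL,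
DysonLiebSimon1978, PitaevskiiStringari1991, QinEtAl2020,
Literature.Barriers.HubbardSuperconductivity.PureModelStripeCompetition]
#5 HardCoreBoseCondensation (dropped at rev 6 — route-repair unused-crux: an engine-calibration
milestone on the XY-in-a-field model, logically disconnected from `closes`, cf. route-review
objection (2); the statement stays recorded as stmt-HubbardSuperconductivity-15001 and in card
function-field-kkt-certificates K3; kept here for the record) — FIRST NON-RP INSTANCE of the engine
(card K3): ground-state Bose–Einstein condensation of hard-core lattice bosons on (ℤ/2kℤ)² OFF half
filling — for some field h the tracial ground-state functional ω of xyTorus 2 (2k) 1 + h·S^z_tot has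
magnetisation density |Re ω(S^z_tot)|/(2k)² ≥ ρ > 0 AND plane long-range order Σ_{x,y} Re ω(S⁰_xS⁰_y
+ S¹_xS¹_y) ≥ c·(2k)⁴ for all large k. At h = 0 (half filling) this is KLS (proved in the tree); off
half filling reflection positivity is lost and the statement is open since
Aizenman–Lieb–Seiringer–Solovej–Yngvason 2004; it is the fixed-field special case of
AposterioriCapRg.KlsOrderOpenness (stmt-1314, n = 1, r = 0, w_x = S^z_x). [difficulty: open-problem]
(why it might fail: Truth is not in doubt numerically (sign-free QMC: superfluid at all fillings),
but every known proof of T=0 continuous-symmetry order in d=2 uses RP, which the field destroys; an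
IR-weighted certificate may need degree growing with 1/ρ_s.) [doi:10.1103/PhysRevA.70.023612,
LSSY2005, KLS1988PRL, Tasaki2019Tower, Kubo1988PRL]
#9 CertificateSoundness (support) — Soundness of the semantic certificate (card D1,
finite-dimensional): in a normalised sector ground state ψ each right-hand term of
CertifiedSectorLRO has expectation ≥ 0 (O†O), ≥ 0 (Q†[H,Q]: Qψ stays in the sector and E₀ =
minEnergyOn), = 0 ([H,R]: eigenvector of a Hermitian H), = 0 (T), so L⁻⁴Re⟨Δ_d†Δ_d⟩ ≥ a − C/L ≥ a/2
for large even L; then HasLongRangeOrder along even sides by the bookkeeping Σ_{x,y}⟨P_x†P_y⟩ =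
⟨Δ_d†Δ_d⟩ (expect_pairField_conjTranspose_mul, torusProj_bijOn_halfOpenBox) and boundedness ‖P_x‖² ≤
32 for the liminf. [difficulty: provable-now] [WangEtAl2024, Scalapino1995]
#9 CertificateCompleteness (support) — Completeness of the semantic interface (calibration: ALL
content of X is finite presentability, none is in the identity's shape): if at some (U,δ) every
normalised sector ground state has L⁻⁴Re⟨Δ_d†Δ_d⟩ ≥ a for all large even L, then CertifiedSectorLRO
holds (with C = 0). Proof: M := L⁻⁴Δ_d†Δ_d − a; T := M − P_K M P_K (K = szSector); split K = V₀ ⊕ V₁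
(ground eigenspace of H|_K, gap γ_L > 0 by finiteness); P₀MP₀ ⪰ 0 is an O†O; off-diagonal blocks are
[H,R] with R = −P₀MP₁G⁻¹ + G⁻¹P₁MP₀, G = (H − E₀)|_V₁; P₁MP₁ + λ(H−E₀)P₁ ⪰ 0 for λ = ‖M‖/γ_L is an
O†O, and −λ(H−E₀)P₁ = λ Σ_χ Q_χ†[H,Q_χ] with Q_χ = |φ₀⟩⟨χ| over an orthonormal basis χ of V₁
(sector-preserving: range ⊂ V₀). [difficulty: provable-now] [FawziFawziScalet2024,
doi:10.1007/s10208-026-09761-x]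

TWO-LAYER PLAN. Foreseen glued splits (nothing filed now): MesoscopicPairOrder ⇐
[FiniteRangeCertificate_R: a pole-free symbol-class certificate of K_R ≥ mR² at fixed
R, degree d] → [R-uniformity of m] → MesoscopicPairOrder; WindowInfraredBound ⇐ [restriction to the
route's fixed (U,δ)] → [PoleOrderOneCertificate:
symbol-class identity CεL² − window sum = SOS + KKT with order-1 multipliers] → WindowInfraredBound;
CertifiedSectorLRO ⇐ SymbolEvaluation
(Nonempty SymbolCertificate → CertifiedSectorLRO, support, informal until the definition lands) ←
HubbardSymbolCertificate (crux 6, informal).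
Engine calibration ladder (methodological, OFF the deciding path MesoscopicPairOrder →
WindowInfraredBound → Assembly → Statement): XyFunctionFieldCertificate (rank 3, informal: RP ground
truth) → hard-core bosons off half filling (stmt-HubbardSuperconductivity-15001: first non-RP; no
longer an item of this route) → HubbardSymbolCertificate (rank 6, informal).

KILL CRITERIA. (a) XY NO-branch proved for all degrees (degree-d pseudo-ground-states of the S=1/2
XY torus satisfying every symbol-class SOS/KKT constraint with
multipliers of pole order ≤ 2 and zero k=0 order) AND the construction transplants to fermion pair
fields ⇒ close `refuted:XyFunctionFieldCertificate`
(census: "bounded-degree KKT cannot see U(1) ground-state order"; hand the pseudo-states to card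
one-sided-certifiability-nogo-bootstrap).
(b) WindowInfraredBound refuted at the route's own (U,δ) window ⇒ BROKEN; repair only by restating
at a fixed (U,δ) with a PDW-excluding ε₀, else close.
(c) MesoscopicPairOrder refuted (a sector ground state without mesoscopic d-wave order throughout
[4,6]×[3/20,1/4]) ⇒ close `refuted:MesoscopicPairOrder`.
(d) Certified SDP infeasibility of HubbardSymbolCertificate at every degree ≤ resources on a (U,δ)
grid while (a) is undecided ⇒ dormant, not closed.
A proof of KacWindowPenalty.WindowGap moots crux 4 (shared / implied items close together).
(AposterioriCapRg.KlsOrderOpenness, stmt-HubbardSuperconductivity-1314, named at open as mooting the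
former crux 5, is REFUTED — AposterioriCapRgKlsOrderOpenness_refuted, negatives index — and crux 5
itself was dropped at rev 6.)

NOT DECOMPOSED YET. The *-algebraic bookkeeping of "symbol-class, numerator degree d, pole order p"
(definition item SymbolCertificate) and the informal cruxes that need it
(XyFunctionFieldCertificate rank 3, HubbardSymbolCertificate rank 6, supports NecessaryPoleOrder and
SymbolEvaluation — filed right after open as
informal statements); the symmetry reduction (U(1)×SU(2)×D₄×translations×particle–hole) of the SDP;
rational rounding near poles (fix the pole part
analytically from the KLS template, optimise the regular part); the semantic twin of the
necessary-pole lemma (Pitaevskii–Stringari T=0 floor: LRO ⇒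
window sum ≥ cεL², i.e. order 1 is also sufficient-side sharp); odd L (unconstrained by the
Statement); any link to WeakCouplingBCS (a(U) ~ e^{−c/U²} is
not rational in U: certificates exist only pointwise in U, hence intermediate coupling).

CHEAPEST FALSIFIER. For the ENGINE: the card's fastest refutation — for the S=1/2 XY torus exhibit a
one-parameter family of degree-2 pseudo-ground-state functionals
(reweighted mixtures of U(1)-twisted KLS states plus a spin-wave correction of the structure factor)
satisfying all symbol-class KKT constraints with
multipliers of pole order ≤ 2 and zero k=0 order; if it extends to every degree, crux 3 dies and the
limitation theorem is the output. For the TYPED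
layer: a lookup — is WindowInfraredBound already false for FREE fermions (U → 0⁺ limit of the d-wave
pair structure factor of the Fermi sea: window sum
∝ ε², fine) or at (8,1/8) by a PDW Bragg peak inside every window (DMRG/AFQMC structure factors,
QinEtAl2020, XuEtAl2024)? I could not run kit
here (plancard seat); both are cheap for a refuter.

NUMBERS. KLS closure: I(2) = 0.646 < 1/√2 (tree: klsIntegral_two_le, 7/10); KLS multipliers have
pole order 2 (1/E_k), necessary floor 1 (twist witnesses,
R-channel l¹ estimate); local pair weight s₀ = L⁻²Σ_x‖P_xψ‖² ≤ 32 with the tree's localPair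
normalisation, d-wave condensate ≈ 1% of it at
intermediate coupling (card sum-rule-ceiling) — irrelevant for the Fejér glue (tail term 32A_ε/R² →
0) but the reason degree ≥ 4, pair-range symbols
are needed in crux 6; target window U ∈ [4,6], δ ∈ [0.15,0.25], excluded stripe box [6,8]×[1/10,1/6]
((8,1/8) witness:
isCuprateRegimeWitness_eight_eighth); Fejér constants: F̂_R(0) = R, tail A_ε = 1/sin²(ε/(2√2)) ≈
8/ε². Items at open: 8 typed (target, assembly,
3 cruxes, 2 supports) + 4 informal + 1 definition; since rev 6: 6 typed (target, assembly, 2 cruxes,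
2 supports — CertificateSoundness proved) + 4 informal.

DEFINITION REQUESTS. D1 `SymbolCertificate U δ d p a` (topic
Summits/HubbardSuperconductivity/HubbardSuperconductivity/Theorems; new object posited for this
problem):
finite lists of (normal-ordered fermionic word pattern in c_{kσ}, c†_{kσ} with momentum
conservation, rational symbol in ℚ(U)(z,w,…)) for SOS
generators O_j with weights s_j ≥ 0 on the torus, sector-preserving KKT generators Q_m with
multipliers a_m of declared pole order ≤ p on the infrared
set {k = 0} ∪ {k = k'}, a symbol-class R, sector terms, and a finite list of scalar lattice-sum
inequalities with explicit O(1/L) errors, such that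
the identity L⁻⁴Δ_d†Δ_d − a = Σ O_j†s_jO_j + Σ Q_m†a_m[H_L,Q_m] + [H_L,R] + T + E_L holds in the CAR
algebra of every torus L ≥ L₀ with ‖E_L‖ ≤ C/L;
plus the XY analogue over Op (TorusSite 2 L) 2. Wanted with it: SymbolEvaluation (Nonempty →
CertifiedSectorLRO) and the closure lemmas (products,
commutators with H, normal ordering preserve rationality; exact evaluation of Laurent-polynomial
lattice sums). Cite facts wanted: none (KLS is a tree theorem).

Novelty: Searches (2026-08-15): `lit frontier HubbardSuperconductivity --since 2021` (30 rows;
certificate-adjacent: arXiv:2410.00810 only; no LRO certificate);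
`lit bridges HubbardSuperconductivity --cross any` (30 rows, none on SOS/bootstrap); `lit galaxy
search --star all` for "sum of squares certificate
long-range order ground state" (0), "bootstrap spontaneous symmetry breaking lattice ground state
semidefinite" (0), "multivariable Fejer-Riesz" (0),
"trigonometric polynomials sums of squares" (0), "infrared bounds without reflection positivity"
(0), "noncommutative polynomial optimization" (8:
MOS-SIAM moment/polynomial optimisation monograph panama:452380315353140, Garner–Araújo Moment
toolkit arXiv:2406.15559, Klep et al. state
polynomials); the 46 open + routed cards of the sub and the 42 Theses files (grep
certificate|Fejér|mesoscopic|localPair: GSCertificate, KacWindowPenalty,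
AposterioriCapRg, ShibaRP, form-factor-squeeze, twist-witness, one-sided-certifiability,
uv-ir-handshake, yrast-landau); `lit search --source crossref` confirmed the ids cited
(Araújo–Klep–Garner–Navascués et al. FoCM 2026 doi:10.1007/s10208-026-09761-x first-order/KKT
conditions; Pironio–Navascués–Acín doi:10.1137/090760155; Helton–McCullough
doi:10.1090/S0002-9947-04-03433-6; Dritschel doi:10.1007/s00020-002-1198-4 and the 2024
two-variable operator-valued factorisation doi:10.1007/s00208-024-02895-9; ALSSY
doi:10.1103/PhysRevA.70.023612); the local searchd index, OpenAlex, S2 and arXiv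
were unavaila  [refs: 10.1007/s10208-026-09761-x, 10.1137/090760155, 10.1090/S0002-9947-04-03433-6, 10.1007/s00020-002-1198-4, 10.1007/s00208-024-02895-9, 10.1103/PhysRevA.70.023612, 2410.00810, 2406.15559, doi:10.1007/s10208-026-09761-x, doi:10.1137/090760155, doi:10.1090/S0002-9947-04-03433-6, doi:10.1007/s00020-002-1198-4, doi:10.1007/s00208-024-02895-9, doi:10.1103/PhysRevA.70.023612, WangEtAl2024, FawziFawziScalet]

Barriers (technique_class: sum-of-squares-certificate+infrared-weighted-KKT): - technique_class: sum-of-squares-certificate+infrared-weighted-KKT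
- Literature.Barriers.HubbardSuperconductivity.LROForcesLowLyingStates: absorbed, not evaded — the
tower/twist states it guarantees are exactly the witnesses forcing pole order ≥ 1 in the window
half; MesoscopicPairOrder is stated so that they do not bite (range-R correlations move by
O((jR/L)²)).
- Literature.Barriers.HubbardSuperconductivity.GeneralizedHartreeFockNoPairing: applies to LOW
DEGREE — a degree-2 certificate sees only quasi-free-stationary data where repulsive U has no
pairing (BLS); evaded only by fermionic degree ≥ 4 with pair-range symbols (recorded as the failure
mode of cruxes 2 and 6).
- Literature.Barriers.HubbardSuperconductivity.SignProblemNPHard: not met — certificates are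
sampling-free dual objects; NP-hardness of generic ground-state problems allows large degree at
fixed (U,δ) but forbids nothing here.
- Literature.Barriers.HubbardSuperconductivity.PerturbativeInvisibilityOfPairing: no expansion in U
or t/U is used; it bites through the coefficient field (a(U) ~ e^{−c/U²} is not rational), so
certificates are pointwise in U and the window is intermediate coupling — the bet is that d = O(1)
suffices there.
- Literature.Barriers.HubbardSuperconductivity.WeakCouplingCeiling: same answer — the route never
enters the weak-coupling regime.
- Literature.Barriers.HubbardSuperconductivity.StrongCouplingCeiling: same — no t/U expansion; U ≤ 6
in the window.
- Literature.Barriers.HubbardSuperco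

History (route lifecycle, newest last):
- 2026-08-16T07:20:13Z · rev 4: restated HardCoreBoseCondensation (stmt-HubbardSuperconductivity-7332) — route-repair (cone; unit rrepair-HubbardSuperconductivity-Funct-8eebd896): the 4 unproved cone facts mermin_wagner{,_general,_magnetisation,_staggered} (Heisenb (planner-rrepair-HubbardSuperconductivity-Funct-8eebd896-0)
- 2026-08-16T07:29:21Z · rev 6: dropped HardCoreBoseCondensation — route-repair (unused-crux; unit rrepair-HubbardSuperconductivity-Funct-f5afc2a7): DROP HardCoreBoseCondensation (stmt-HubbardSuperconductivity-15001). It is an (planner-rrepair-HubbardSuperconductivity-Funct-f5afc2a7-0)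
- 2026-08-23T20:55:54Z · DORMANT — reconciler: no traction for 6.2 d (last activity item-evidence-added at 2026-08-17T14:33:13Z); parked, not closed — `ledger route dormant route-HubbardSupercond (operator:999:2131946)

sub-problem: HubbardSuperconductivity · status: dormant · opened planner-plancard-HubbardSuperconductivity-Hub-88085e4a-0 2026-08-15T12:08:14Z · rev 8 · ledger route-HubbardSuperconductivity-FunctionFieldCertificate
GENERATED by the gate from the ledger (D-0016/17). Provers cite these decls: `theorem foo : Summit.HubbardSuperconductivity.HubbardSuperconductivity.Theses.FunctionFieldCertificate.<Decl> := …` in Summits/HubbardSuperconductivity/HubbardSuperconductivity/Theorems/<Name>.lean.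
-/

namespace Summit.HubbardSuperconductivity.HubbardSuperconductivity.Theses.FunctionFieldCertificate

open scoped BigOperators Topology Manifold Classical MeasureTheory ProbabilityTheory Matrix InnerProductSpace ComplexConjugate ContinuousMap
open Filter Set Function TopologicalSpace MeasureTheory

attribute [summit_statement] _root_.HubbardSuperconductivity

open Literature.Hubbard

/-- item stmt-HubbardSuperconductivity-7330 · target · rank 0 · open · by planner
why it might fail: By CertificateSoundness/Completeness it is EQUIVALENT to every-GS uniform LRO ≥ a−C/L on all large even tori at one (U,δ): false if S fails at every (U,δ) (numerics: Δ∞=0.006(4) at (4,1/6), stripes at U~6-8, QinEtAl2020) or if the finite-size LRO approaches its limit slower than C/L from below.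
sources: WangEtAl2024, FawziFawziScalet2024, KLS1988PRL, QinEtAl2020, doi:10.1007/s10208-026-09761-x
[target] X's typed shadow: there are U > 0, δ ∈ (0,1/2), a > 0, C and L₀ such that for every even L
≥ L₀ there exist finitely many matrices O_i, sector-preserving Q_i, a matrix R and a sector term T
(zero expectation on szSector N_L 0) with L⁻⁴·Δ_d†Δ_d − (a − C/L)·1 = Σ O_i†O_i + Σ Q_i†(H_L Q_i −
Q_i H_L) + (H_L R − R H_L) + T, H_L = hubbardTorus 2 L 1 U — exactly what evaluating a
function-field certificate at the L-th roots of unity produces. -/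
@[route_item "route-HubbardSuperconductivity-FunctionFieldCertificate"]
def CertifiedSectorLRO : Prop :=
  ∃ U : ℝ, 0 < U ∧ ∃ δ ∈ Set.Ioo (0:ℝ) (1 / 2), ∃ a C : ℝ, 0 < a ∧ ∃ L₀ : ℕ, ∀ (L : ℕ) [NeZero L], L₀ ≤ L → Even L → ∃ (n m : ℕ) (O : Fin n → Matrix (Finset (Literature.MathematicalPhysics.QuantumLattice.Orb (Literature.MathematicalPhysics.QuantumLattice.FermionTorus 2 L))) (Finset (Literature.MathematicalPhysics.QuantumLattice.Orb (Literature.MathematicalPhysics.QuantumLattice.FermionTorus 2 L))) ℂ) (Q : Fin m → Matrix (Finset (Literature.MathematicalPhysics.QuantumLattice.Orb (Literature.MathematicalPhysics.QuantumLattice.FermionTorus 2 L))) (Finset (Literature.MathematicalPhysics.QuantumLattice.Orb (Literature.MathematicalPhysics.QuantumLattice.FermionTorus 2 L))) ℂ) (R T : Matrix (Finset (Literature.MathematicalPhysics.QuantumLattice.Orb (Literature.MathematicalPhysics.QuantumLattice.FermionTorus 2 L))) (Finset (Literature.MathematicalPhysics.QuantumLattice.Orb (Literature.MathematicalPhysics.QuantumLattice.FermionTorus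 2 L))) ℂ), (∀ (i : Fin m) (ψ : Literature.MathematicalPhysics.QuantumLattice.Fock (Literature.MathematicalPhysics.QuantumLattice.Orb (Literature.MathematicalPhysics.QuantumLattice.FermionTorus 2 L))), ψ ∈ Literature.MathematicalPhysics.QuantumLattice.szSector (2 * ⌊(1 - δ) * (L : ℝ) ^ 2 / 2⌋₊) 0 → Matrix.mulVec (Q i) ψ ∈ Literature.MathematicalPhysics.QuantumLattice.szSector (2 * ⌊(1 - δ) * (L : ℝ) ^ 2 / 2⌋₊) 0) ∧ (∀ ψ : Literature.MathematicalPhysics.QuantumLattice.Fock (Literature.MathematicalPhysics.QuantumLattice.Orb (Literature.MathematicalPhysics.QuantumLattice.FermionTorus 2 L)), ψ ∈ Literature.MathematicalPhysics.QuantumLattice.szSector (2 * ⌊(1 - δ) * (L : ℝ) ^ 2 / 2⌋₊) 0 → star ψ ⬝ᵥ Matrix.mulVec T ψ = 0) ∧ (1 / (L : ℂ) ^ 4) • (Matrix.conjTranspose (Literature.MathematicalPhysics.QuantumLattice.pairField Literature.MathematicalPhysics.QuantumLattice.dWaveFormFactor L) * Literature.MathematicalPhysics.QuantumLattice.pairField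 Literature.MathematicalPhysics.QuantumLattice.dWaveFormFactor L) - ((a - C / (L : ℝ) : ℝ) : ℂ) • (1 : Matrix (Finset (Literature.MathematicalPhysics.QuantumLattice.Orb (Literature.MathematicalPhysics.QuantumLattice.FermionTorus 2 L))) (Finset (Literature.MathematicalPhysics.QuantumLattice.Orb (Literature.MathematicalPhysics.QuantumLattice.FermionTorus 2 L))) ℂ) = ∑ i : Fin n, Matrix.conjTranspose (O i) * O i + ∑ i : Fin m, Matrix.conjTranspose (Q i) * (Literature.MathematicalPhysics.QuantumLattice.hubbardTorus 2 L 1 U * Q i - Q i * Literature.MathematicalPhysics.QuantumLattice.hubbardTorus 2 L 1 U) + (Literature.MathematicalPhysics.QuantumLattice.hubbardTorus 2 L 1 U * R - R * Literature.MathematicalPhysics.QuantumLattice.hubbardTorus 2 L 1 U) + T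

/-- item stmt-HubbardSuperconductivity-7331 · crux · rank 2 · open · by planner
why it might fail: Needs ONE (U,δ) with a d-wave margin m uniform over EVERY (N_L,0) ground state: at the window point (4,1/6) AFQMC extrapolates the order parameter to 0.006(4)≈0 (QinEtAl2020 §III D), U~6-8 is striped; weak coupling gives ln m ~ −(t/U)², invisible to bounded-degree (≥4, GHF) certificates.
sources: QinEtAl2020, ArovasBergKivelsonRaghu2022, KomaTasaki1994, Tasaki2019Tower, WangEtAl2024, Literature.Barriers.HubbardSuperconductivity.PureModelStripeCompetition
[crux] POLE-FREE HALF (card §5: what a Laurent-polynomial, i.e. finite-range, certificate can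
prove). At some U > 0, δ ∈ (0,1/2) there is m > 0 such that for arbitrarily large scales R, all
large even L and EVERY normalised (N_L,0)-sector ground state ψ of hubbardTorus 2 L 1 U, the
Fejér-box average of the d-wave pair correlation is ≥ m: L⁻² Σ_{x,y} Π_i (1 − |(y−x)_i|_L/R)₊
Re⟨P_xψ, P_yψ⟩ ≥ m R² (P_x = localPair dWaveFormFactor L x). Twisted states do not defeat it (a
winding-j twist changes correlations at range R by O((jR/L)²)), so FINITE-RANGE SOS+KKT families are
admissible certificates here. [difficulty: open-problem] -/
@[route_item "route-HubbardSuperconductivity-FunctionFieldCertificate", crux]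
def MesoscopicPairOrder : Prop :=
  ∃ U : ℝ, 0 < U ∧ ∃ δ ∈ Set.Ioo (0:ℝ) (1 / 2), ∃ m : ℝ, 0 < m ∧ ∀ R₀ : ℕ, ∃ R : ℕ, R₀ ≤ R ∧ ∃ L₀ : ℕ, ∀ (L : ℕ) [NeZero L], L₀ ≤ L → Even L → ∀ ψ : Literature.MathematicalPhysics.QuantumLattice.Fock (Literature.MathematicalPhysics.QuantumLattice.Orb (Literature.MathematicalPhysics.QuantumLattice.FermionTorus 2 L)), star ψ ⬝ᵥ ψ = 1 → Literature.MathematicalPhysics.QuantumLattice.IsGroundStateInSector (Literature.MathematicalPhysics.QuantumLattice.hubbardTorus 2 L 1 U) (2 * ⌊(1 - δ) * (L : ℝ) ^ 2 / 2⌋₊) 0 ψ → m * (R : ℝ) ^ 2 ≤ (∑ x : Fin 2 → ZMod L, ∑ y : Fin 2 → ZMod L, (∏ i : Fin 2, max 0 (1 - |(((y i - x i).valMinAbs : ℤ) : ℝ)| / (R : ℝ))) * (star (Matrix.mulVec (Literature.MathematicalPhysics.QuantumLattice.localPair Literature.MathematicalPhysics.QuantumLattice.dWaveFormFactor L x) ψ)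 ⬝ᵥ Matrix.mulVec (Literature.MathematicalPhysics.QuantumLattice.localPair Literature.MathematicalPhysics.QuantumLattice.dWaveFormFactor L y) ψ).re) / (L : ℝ) ^ 2

/-- item stmt-HubbardSuperconductivity-1089 · crux · rank 4 · open · by planner
why it might fail: Stated ∀(U,δ): one sector GS anywhere with phase separation (mVMC: U=10, δ≲0.2, MisawaImada2014), a PDW with |Q|→0 or a q~1/L mesoscopic condensate gives T_ε ≳ L² ≫ CεL²; and no RP-free T=0 infrared upper bound is known for any quantum lattice model (Nachtergaele 2006 §3), let alone itinerant ones.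
sources: KLS1988PRL, DysonLiebSimon1978, PitaevskiiStringari1991, MisawaImada2014, QinEtAl2020, arXiv:math-ph/0603017
[crux] WINDOW INFRARED BOUND, Σ-form, every ground state (card step (3)). ∀ U > 0, δ ∈ (0,1/2) ∃ C ≥
0, ε₀ > 0, L₀: ∀ ε ∈ (0,ε₀], ∀ even L ≥ L₀, ∀ normalised sector ground states ψ of H_L:  T_ε(ψ) =
L⁻² Σ_{m≠0, |q_m|≤ε} ‖Δ_d(m)ψ‖² ≤ C ε L². This is the Goldstone shape S_ψ(q) := L⁻²‖Δ_d(m)ψ‖² ≲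
c/|q| summed over the ≈ ε²L²/4π window momenta (a flat S_ψ(q) ≤ c gives the stronger Cε²); it says:
no macroscopic d-wave pair weight at small NONZERO momenta in any sector ground state — no
pair-density wave inside the window, no phase separation into superconducting puddles, phase
fluctuations no softer than a linear Goldstone mode. Pointwise in (U,δ) (constants may blow up near
phase boundaries). ENGINE QUESTION: T=0 infrared UPPER bounds are known only via reflection
positivity (KLS1988PRL; Tasaki2020) and the doped Hubbard model is not RP. Intended tenure split:
(3a) Pitaevskii–Stringari T=0 inequality S_ψ(q)L² ≤ ½√(χ_L(q) f_L(q)) with f the double commutator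
⟨[[Δ_d(m)ᴴ,H],Δ_d(m)]⟩ = O(L²) (finite-dimensional; the GS-degenerate part of Δ_d(m)ψ needs separate
bookkeeping) and (3b) a uniform static pair-susceptibility bound χ_L(q) ≤ C'L²/|q|² on the window,
an ENERGY statement (second-orde -/
@[route_item "route-HubbardSuperconductivity-FunctionFieldCertificate", crux]
def WindowInfraredBound : Prop :=
  ∀ U : ℝ, 0 < U → ∀ δ ∈ Set.Ioo (0:ℝ) (1 / 2), ∃ C ε₀ : ℝ, 0 ≤ C ∧ 0 < ε₀ ∧ ∃ L₀ : ℕ, ∀ ε ∈ Set.Ioc (0:ℝ) ε₀, ∀ (L : ℕ) [NeZero L], L₀ ≤ L → Even L → let D : (Fin 2 → ZMod L) → Matrix (Finset (Literature.MathematicalPhysics.QuantumLattice.Orb (Literature.MathematicalPhysics.QuantumLattice.FermionTorus 2 L))) (Finset (Literature.MathematicalPhysics.QuantumLattice.Orb (Literature.MathematicalPhysics.QuantumLattice.FermionTorus 2 L))) ℂ := fun m => ∑ x : Fin 2 → ZMod L, Complex.exp (-(2 * Real.pi * Complex.I * (((∑ i : Fin 2, m i * x i).val : ℕ) : ℂ)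 / (L : ℂ))) • Literature.MathematicalPhysics.QuantumLattice.localPair Literature.MathematicalPhysics.QuantumLattice.dWaveFormFactor L x; ∀ ψ : Literature.MathematicalPhysics.QuantumLattice.Fock (Literature.MathematicalPhysics.QuantumLattice.Orb (Literature.MathematicalPhysics.QuantumLattice.FermionTorus 2 L)), star ψ ⬝ᵥ ψ = 1 → Literature.MathematicalPhysics.QuantumLattice.IsGroundStateInSector (Literature.MathematicalPhysics.QuantumLattice.hubbardTorus 2 L 1 U) (2 * ⌊(1 - δ) * (L : ℝ) ^ 2 / 2⌋₊) 0 ψ → (∑ m : Fin 2 → ZMod L, if m ≠ 0 ∧ (2 * Real.pi / (L : ℝ)) ^ 2 * (∑ i : Fin 2, (((m i).valMinAbs : ℤ) : ℝ) ^ 2) ≤ ε ^ 2 then (star (Matrix.mulVec (D m) ψ) ⬝ᵥ Matrix.mulVec (D m) ψ).re / (L : ℝ) ^ 2 else 0) ≤ C * ε * (L : ℝ) ^ 2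

-- item stmt-HubbardSuperconductivity-7742 · support · rank 3 · open · by planner — informal only, no Lean statement yet:
--   [crux] XY CALIBRATION, YES BRANCH OF THE XY DICHOTOMY (card function-field-kkt-certificates K1). For
--   the S = 1/2 ferromagnetic quantum XY model xyTorus 2 L 1 on even tori there exist a numerator degree
--   d, a pole order p <= 2 and a > 0 with Nonempty (XY-SymbolCertificate d p a): finitely many
--   symbol-class SOS generators (trigonometric-rational weights s_j >= 0), KKT generators Q_m
--   (S^z_tot-preserving) with multipliers of pole order <= p at k = 0, a symbol-class R, and finitely
--   many scalar Riemann-sum inequalities, such that (2k)^-4 Sum_{x,y} (S^0_x S^0_y + S^1_x S^1_y) - a*1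
--   = Sum_j O_j^+ s_j O

-- item stmt-HubbardSuperconductivity-7755 · support · rank 6 · open · by planner — informal only, no Lean statement yet:
--   [crux] CONSTRUCTION ON THE SUMMIT MODEL (card function-field-kkt-certificates K4): there are
--   rational U in [4,6] and delta in [3/20,1/4] (away from the stripe box [6,8]x[1/10,1/6]), a numerator
--   degree d (fermionic degree >= 4 with relative-coordinate symbols of pair range ~ xi_pair), pole
--   order p <= 2 and rational a > 0 with Nonempty (SymbolCertificate U delta d p a) for L^-4 Delta_d^+
--   Delta_d - a, H_L = hubbardTorus 2 L 1 U, sectors (N_L, S^z = 0), N_L = 2*floor((1-delta)L^2/2):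
--   symbol-class SOS + KKT (pole-order <= p multipliers) + [H,R] + sector terms + scalar Riemann-sum
--   inequalities, an i

/-- item stmt-HubbardSuperconductivity-7333 · support · rank 9 · closed · proved by Summit.HubbardSuperconductivity.HubbardSuperconductivity.Theorems.certificateSoundness_proof @ bcf72b61eeab (prover) · by planner
sources: WangEtAl2024, Scalapino1995
[support] Soundness of the semantic certificate (card D1, finite-dimensional): in a normalised
sector ground state ψ each right-hand term of CertifiedSectorLRO has expectation ≥ 0 (O†O), ≥ 0
(Q†[H,Q]: Qψ stays in the sector and E₀ = minEnergyOn), = 0 ([H,R]: eigenvector of a Hermitian H), =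
0 (T), so L⁻⁴Re⟨Δ_d†Δ_d⟩ ≥ a − C/L ≥ a/2 for large even L; then HasLongRangeOrder along even sides
by the bookkeeping Σ_{x,y}⟨P_x†P_y⟩ = ⟨Δ_d†Δ_d⟩ (expect_pairField_conjTranspose_mul,
torusProj_bijOn_halfOpenBox) and boundedness ‖P_x‖² ≤ 32 for the liminf. [difficulty: provable-now] -/
@[route_item "route-HubbardSuperconductivity-FunctionFieldCertificate"]
def CertificateSoundness : Prop :=
  CertifiedSectorLRO → HubbardSuperconductivity

/-- item stmt-HubbardSuperconductivity-7334 · support · rank 9 · closed · proved by Summit.HubbardSuperconductivity.HubbardSuperconductivity.Theorems.certificateCompleteness_proof @ 599271dfc820 (prover) · by planner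
sources: FawziFawziScalet2024, doi:10.1007/s10208-026-09761-x
[support] Completeness of the semantic interface (calibration: ALL content of X is finite
presentability, none is in the identity's shape): if at some (U,δ) every normalised sector ground
state has L⁻⁴Re⟨Δ_d†Δ_d⟩ ≥ a for all large even L, then CertifiedSectorLRO holds (with C = 0).
Proof: M := L⁻⁴Δ_d†Δ_d − a; T := M − P_K M P_K (K = szSector); split K = V₀ ⊕ V₁ (ground eigenspace
of H|_K, gap γ_L > 0 by finiteness); P₀MP₀ ⪰ 0 is an O†O; off-diagonal blocks are [H,R] with R =
−P₀MP₁G⁻¹ + G⁻¹P₁MP₀, G = (H − E₀)|_V₁; P₁MP₁ + λ(H−E₀)P₁ ⪰ 0 for λ = ‖M‖/γ_L is an O†O, and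
−λ(H−E₀)P₁ = λ Σ_χ Q_χ†[H,Q_χ] with Q_χ = |φ₀⟩⟨χ| over an orthonormal basis χ of V₁
(sector-preserving: range ⊂ V₀). [difficulty: provable-now] -/
@[route_item "route-HubbardSuperconductivity-FunctionFieldCertificate", crux]
def CertificateCompleteness : Prop :=
  (∃ U : ℝ, 0 < U ∧ ∃ δ ∈ Set.Ioo (0:ℝ) (1 / 2), ∃ a : ℝ, 0 < a ∧ ∃ L₀ : ℕ, ∀ (L : ℕ) [NeZero L], L₀ ≤ L → Even L → ∀ ψ : Literature.MathematicalPhysics.QuantumLattice.Fock (Literature.MathematicalPhysics.QuantumLattice.Orb (Literature.MathematicalPhysics.QuantumLattice.FermionTorus 2 L)), star ψ ⬝ᵥ ψ = 1 → Literature.MathematicalPhysics.QuantumLattice.IsGroundStateInSector (Literature.MathematicalPhysics.QuantumLattice.hubbardTorus 2 L 1 U) (2 * ⌊(1 - δ) * (L : ℝ) ^ 2 / 2⌋₊) 0 ψ → a ≤ (star ψ ⬝ᵥ Matrix.mulVec (Matrix.conjTranspose (Literature.MathematicalPhysics.QuantumLattice.pairField Literature.MathematicalPhysics.QuantumLattice.dWaveFormFactor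 L) * Literature.MathematicalPhysics.QuantumLattice.pairField Literature.MathematicalPhysics.QuantumLattice.dWaveFormFactor L) ψ).re / (L : ℝ) ^ 4) → CertifiedSectorLRO

-- item stmt-HubbardSuperconductivity-7792 · support · rank 9 · open · by planner — informal only, no Lean statement yet:
--   [support] NECESSARY-POLE LEMMA (card function-field-kkt-certificates K2; calibrates the definition;
--   provable in the style of GSCertificate stmt-HubbardSuperconductivity-0407 once SymbolCertificate
--   lands): for every valid function-field certificate of k = 0 d-wave pair order a > 0 (any U, delta,
--   numerator degree d) and every eta > 0, the infrared weight Sum_{k != 0, |k| < eta} (Sum_m |a_m(k)| +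
--   |r(k)|) of the KKT multipliers and of the R-symbol is unbounded as L -> infinity; equivalently some
--   multiplier has a pole of order >= 1 on the infrared set. Proof sketch: evaluate the identity in the
--   U(1

-- item stmt-HubbardSuperconductivity-7807 · support · rank 9 · open · by planner — informal only, no Lean statement yet:
--   [support] EVALUATION / SOUNDNESS OF THE FINITE PRESENTATION (card function-field-kkt-certificates D1
--   + P1): Nonempty (SymbolCertificate U delta d p a) -> CertifiedSectorLRO (stmt-7330) with the same U,
--   delta, a and some C, L_0. Content: (i) symbol-class closure — products, adjoints, commutators with
--   hubbardTorus 2 L 1 U (the kinetic commutator multiplies a symbol by eps(k_out) - eps(k_in); the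
--   U-commutator raises fermionic degree by 2) and normal ordering preserve rationality of symbols, and
--   fully contracted scalars of Laurent-POLYNOMIAL symbols are exact rationals (Sum_{k in grid} z^m =
--   L^2 [

/-- item stmt-HubbardSuperconductivity-7335 · assembly · rank 1 · closed · proved by Summit.HubbardSuperconductivity.HubbardSuperconductivity.Theorems.functionFieldCertificate_assembly_structural (prover) · by planner
sources: KLS1988PRL, DysonLiebSimon1978, Scalapino1995
[assembly] MesoscopicPairOrder → WindowInfraredBound → HubbardSuperconductivity (Fejér-kernel
Parseval identity on (ℤ/Lℤ)², window/tail split, norm bound ‖P_x‖² ≤ 32, liminf bookkeeping over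
even sides). -/
@[route_item "route-HubbardSuperconductivity-FunctionFieldCertificate"]
def Assembly : Prop :=
  MesoscopicPairOrder → WindowInfraredBound → HubbardSuperconductivity

/-- `Assembly` holds: proved by `Summit.HubbardSuperconductivity.HubbardSuperconductivity.Theorems.functionFieldCertificate_assembly_structural`. -/
theorem Assembly_holds : Assembly := _root_.Summit.HubbardSuperconductivity.HubbardSuperconductivity.Theorems.functionFieldCertificate_assembly_structural

-- records of items no longer active in this route (dropped / restated):
-- earlier HardCoreBoseCondensation (stmt-HubbardSuperconductivity-7332, replaced 2026-08-16T07:20:13Z -> stmt-HubbardSuperconductivity-15001): retired by None — ∃ h c ρ : ℝ, 0 < c ∧ 0 < ρ ∧ ∃ k₀ : ℕ, ∀ k : ℕ, k₀ ≤ k → ∀ [NeZero (2 * k)], ρ ≤ |((Literature.MathematicalPhysics.QuantumLattice.xyTorus 2 (2 * k) 1 + (h : ℂ) • Literature.MathematicalPhysics.QuantumLattice.totalSpin 1 2).groundStateFunctio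

/-! D-0027 §2.1 — DECIDING THEOREM (planner-authored via `route open/edit --closes-file`; by planner-rbadge-HubbardSuperconductivity-Functi-8eebd896-g3-0 2026-08-16T07:49:10Z):
its hypotheses are this route's items and its conclusion the sub-problem Statement (glue_lint), and it elaborates with this file. -/

/-- Deciding theorem (D-0027 §2.1), CRUX-ONLY form (human ruling 2026-08-16: only `crux` items may be
hypotheses of `closes`; glue / support / assembly statements are PROVED lemmas invoked inside the term).
The route's two ranked halves — the pole-free half `MesoscopicPairOrder` (Fejér-box `d`-wave pair order
`≥ m R²` at arbitrarily large block scales `R`, in every normalised `(N_L, S^z = 0)`-sector ground state,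
at one `(U, δ)`) and the pole half `WindowInfraredBound` (Σ-form window infrared bound
`Σ_{m ≠ 0, |q_m| ≤ ε} S_ψ(m) ≤ C ε L²`) — imply the Statement by the LANDED structural proof of the
route's `Assembly` implication, `Theorems.functionFieldCertificate_assembly_structural` (p89257,
`Theorems/FunctionFieldCertificateAssemblyStructural.lean`; Fejér–Parseval glue on the dual torus
`(ℤ/Lℤ)²`: tent identity + Fejér closure `fejer_glue` of p88699, window monotonicity, constants
`ε := min ε₀ (m/(8(C+1)))`, `R ≥ ⌈8K/m⌉ + 1`, `K = 2π²C_d²/ε²`, and the `liminf` bookkeeping along even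
sides), whose type is the verbatim bodies `MesoscopicPairOrder → WindowInfraredBound →
_root_.HubbardSuperconductivity` (δ-equal to `Assembly`; that module imports no Theses file, so the
import is cycle-free). The items `Assembly` (the implication itself, linked by the gate as
`Assembly_holds`), `CertifiedSectorLRO`, `CertificateSoundness`, `CertificateCompleteness` are
deliberately NOT hypotheses. -/
@[closes "route-HubbardSuperconductivity-FunctionFieldCertificate"] theorem closes (hMeso : MesoscopicPairOrder) (hWindow : WindowInfraredBound) :
    _root_.HubbardSuperconductivity :=
  _root_.Summit.HubbardSuperconductivity.HubbardSuperconductivity.Theorems.functionFieldCertificate_assembly_structural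
    hMeso hWindow

end Summit.HubbardSuperconductivity.HubbardSuperconductivity.Theses.FunctionFieldCertificate
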